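import Summits.QuantumFields.GaugeBoot.TiltedBoxLimitAxisRP
import Summits.QuantumFields.GaugeBoot.TiltedSiteRPAnyBeta
import HarnessLib

/-!
# Tilted limit points are site-reflection positive along `k ∉ {i, j}` at EVERY real coupling
# (gauge-boot, L3 structural supplement: infinite-volume form of `TiltedSiteRPAnyBeta`)

HONEST FRAMING (cell `pub-gaugeboot`, page 1 of every file): the venture produces certified bounds
on lattice expectations at stated coupling, gauge group, dimension and torus size; NOT a mass gap,
NOT a continuum limit, NOT a string tension; NOT Yang–Mills-summit-bearing (barriers
`FixedCouplingUltralocality`, `PerturbativeInvisibility`). Structural POSITIVE facts about a class of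
infinite-volume Wilson states; nothing else is claimed.

`TiltedBoxLimitAxisRP.lean` proved that for `β ≥ 0` every tilted limit point
`μ ∈ tiltedBoxLimitPoints d i j ρ β` (limits of the Wilson states of the 45°-tilted boxes
`ℤ^d/Γ(M_k + 2, M_k + 2, 2(Q_k + 2))`, `TiltedBoxLimitPoints.lean`) is reflection positive in the site
hyperplane `x_k = 0` of every transverse axis `k ∉ {i, j}` (`siteRP_of_mem_tiltedBoxLimitPoints`). Its
hypothesis `0 ≤ β` came from the box theorem `tiltedBox_siteRP`, where it was idle
(`TiltedSiteRPAnyBeta.lean`: a site reflection cuts no plaquette). Re-running the three steps (box step,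
continuous cylinders, `IsReflectionPositiveFor.of_continuous_cylinder`) on `tiltedBox_siteRP_anyBeta`:

* `box_siteRP_nonneg_anyBeta`, `integral_siteReflect_nonneg_of_cylinder_anyBeta`,
* **`siteRP_of_mem_tiltedBoxLimitPoints_anyBeta`**: for EVERY real `β`, compact Hausdorff second
  countable `G`, continuous `ρ`, `k ∉ {i, j}` (`i ≠ j`), every tilted limit point is
  `IsReflectionPositiveFor (configSiteReflect k) (siteHalfEdges k) μ`;
* `siteBlock_nonneg_of_mem_tiltedBoxLimitPoints_anyBeta` (PSD site blocks of the limit state).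

The LINK statement `linkRP_of_mem_tiltedBoxLimitPoints` keeps `0 ≤ β` (cut plaquettes; nothing is
claimed about it at `β < 0`). The torus limit points `infiniteVolumeLimitPoints ρ β` of `ClassB*.lean`
also keep `0 ≤ β` for their site statement: that set contains limits along ODD sides, whose site
mirror (`torus_siteRP_nonneg_odd`, antipodal cut) does use the sign. Nothing about Class B changes
(Class B asks for link and diagonal positivity as well).

References: K. Osterwalder, E. Seiler, Ann. Phys. 110 (1978) 440, §2; J. Fröhlich, R. Israel,
E. H. Lieb, B. Simon, Comm. Math. Phys. 62 (1978) 1, Thm. 2.1; S. Friedli, Y. Velenik (2017) Ch. 10.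
-/

noncomputable section

open MeasureTheory Filter Topology
open scoped ComplexOrder ComplexConjugate
open Literature.MathematicalPhysics.QuantumLattice

namespace Summit.QuantumFields.GaugeBoot

namespace TiltedRP

variable {d : ℕ} {i j k : Fin d} {N : ℕ}
variable {G : Type*} [Group G] [TopologicalSpace G] [IsTopologicalGroup G] [CompactSpace G]
  [MeasurableSpace G] [BorelSpace G] [SecondCountableTopology G]
variable (ρ : G →* Matrix (Fin N) (Fin N) ℂ)

/-! ## Box step at every real coupling -/

section Box

variable {Mu Mv Q : ℕ} [NeZero Mu] [NeZero Mv] [NeZero Q]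

/-- **Box step, site mirror, every real `β`**: on a box of transverse period `2Q`, `Q ≥ 2`,
`Q ≥ m + 1`, the site RP pairing along `k ∉ {i, j}` of the lift of a bounded measurable cylinder
observable of `{x_k ≥ 0}` with `x_k ≤ m` on its support is non-negative (`tiltedBox_siteRP_anyBeta`). -/
theorem box_siteRP_nonneg_anyBeta (hki : k ≠ i) (hkj : k ≠ j) (hQ : 2 ≤ Q) (hρ : Continuous ρ)
    (β : ℝ) {F : LGConfig d G → ℂ} {T : Finset (ZdEdge d)} (hFT : IsCylinder F T)
    (hFm : Measurable F) {C : ℝ} (hC : ∀ U, ‖F U‖ ≤ C) (hT : ∀ e ∈ T, e ∈ siteHalfEdges k) {m : ℕ}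
    (hTm : ∀ e ∈ T, e.1 k ≤ m) (hm : m + 1 ≤ Q) :
    0 ≤ ∫ U, conj (F (configSiteReflect k (tiltedLift d i j Mu Mv (2 * Q) U))) *
      F (tiltedLift d i j Mu Mv (2 * Q) U) ∂(gibbs ρ (tiltedUnit d i j Mu Mv (2 * Q)) β) := by
  have hpos := tiltedBox_siteRP_anyBeta ρ hki hkj hQ hρ β (fun U => F (tiltedLift d i j Mu Mv (2 * Q) U))
    (hFm.comp (measurable_tiltedLift d i j Mu Mv (2 * Q))) ⟨C, fun U => hC _⟩
    (isHalfObservable_site_comp_tiltedLift hki hkj hFT hT hTm hm)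
  simpa only [tiltedLift_configReflect] using hpos

end Box

/-! ## Site RP of the limit points at every real coupling -/

/-- **The site RP pairing of a tilted limit point along `k ∉ {i, j}` is non-negative on continuous
cylinder observables of `{x_k ≥ 0}`, for every real `β`.** -/
theorem integral_siteReflect_nonneg_of_cylinder_anyBeta (hki : k ≠ i) (hkj : k ≠ j)
    (hρ : Continuous ρ) {β : ℝ} {μ : Measure (LGConfig d G)} (hμ : μ ∈ tiltedBoxLimitPoints d i j ρ β)
    {F : LGConfig d G → ℂ} {T : Finset (ZdEdge d)} (hFT : IsCylinder F T) (hFc : Continuous F)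
    {C : ℝ} (hC : ∀ U, ‖F U‖ ≤ C) (hFS : DependsOn F (siteHalfEdges k)) :
    0 ≤ ∫ U, conj (F (configSiteReflect k U)) * F U ∂μ := by
  classical
  obtain ⟨M, Q, -, hQ, h⟩ := hμ
  set T' : Finset (ZdEdge d) := T.filter (· ∈ siteHalfEdges (d := d) k) with hT'
  have hFT' : IsCylinder F T' := isCylinder_filter_of_dependsOn hFT hFS
  have hTh : ∀ e ∈ T', e ∈ siteHalfEdges k := fun e he => (Finset.mem_filter.1 he).2
  obtain ⟨m, hm⟩ : ∃ m : ℕ, ∀ e ∈ T', e.1 k ≤ m := by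
    refine ⟨T'.sup fun e => (e.1 k).toNat, fun e he => ?_⟩
    have hle := Finset.le_sup (f := fun e : ZdEdge d => (e.1 k).toNat) he
    have : (e.1 k).toNat ≤ T'.sup fun e : ZdEdge d => (e.1 k).toNat := hle
    omega
  set H : LGConfig d G → ℂ := fun U => conj (F (configSiteReflect k U)) * F U with hH
  have hHc : Continuous H :=
    (Complex.continuous_conj.comp (hFc.comp (continuous_configSiteReflect k))).mul hFc
  obtain ⟨T₁, hT₁⟩ : ∃ T₁ : Finset (ZdEdge d), IsCylinder (F ∘ configSiteReflect k) T₁ :=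
    ⟨_, isCylinder_comp_configSiteReflect hFT k⟩
  have hHcyl : IsCylinder H (T₁ ∪ T) := by
    intro U V hUV
    have e1 := hT₁ fun e he => hUV e (by rw [Finset.coe_union]; exact Or.inl he)
    have e2 := hFT fun e he => hUV e (by rw [Finset.coe_union]; exact Or.inr he)
    simp only [Function.comp_apply] at e1
    simp only [hH, e1, e2]
  have hHb : ∀ U, ‖H U‖ ≤ C * C := fun U => by
    simp only [hH, norm_mul, Complex.norm_conj]
    exact mul_le_mul (hC _) (hC _) (norm_nonneg _) ((norm_nonneg (F U)).trans (hC U))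
  refine h.integral_nonneg_of_eventually hρ hHcyl hHc hHb ?_
  have hev : ∀ᶠ n in atTop, m ≤ Q n := hQ.eventually_ge_atTop m
  refine hev.mono fun n hn => ?_
  exact box_siteRP_nonneg_anyBeta ρ hki hkj (by omega) hρ β hFT' hFc.measurable hC hTh hm (by omega)

/-! ## The `siteRP` field for the transverse axes at every real coupling -/

variable [T2Space G]

/-- **Site reflection positivity of every tilted limit point along `k ∉ {i, j}`, at EVERY real
coupling**: for compact Hausdorff second countable `G`, continuous `ρ`, `β ∈ ℝ`, `i ≠ j`, and
`μ ∈ tiltedBoxLimitPoints d i j ρ β`, the site mirror `x_k ↦ -x_k` is of positive type on all bounded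
measurable observables of the closed half `{x_k ≥ 0}`. Supersedes `siteRP_of_mem_tiltedBoxLimitPoints`
(`0 ≤ β`). -/
theorem siteRP_of_mem_tiltedBoxLimitPoints_anyBeta (hki : k ≠ i) (hkj : k ≠ j) (hij : i ≠ j)
    (hρ : Continuous ρ) {β : ℝ} {μ : Measure (LGConfig d G)}
    (hμ : μ ∈ tiltedBoxLimitPoints d i j ρ β) :
    IsReflectionPositiveFor (configSiteReflect (G := G) k) (siteHalfEdges k) μ := by
  haveI := isProbabilityMeasure_of_mem_tiltedBoxLimitPoints hμ
  exact IsReflectionPositiveFor.of_continuous_cylinder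
    (reflectInvariant_of_mem_tiltedBoxLimitPoints ρ hij hρ hμ k)
    fun F T hFT hFc ⟨C, hC⟩ hFS =>
      integral_siteReflect_nonneg_of_cylinder_anyBeta ρ hki hkj hρ hμ hFT hFc hC hFS

/-- **The site RP blocks along `k ∉ {i, j}` of a tilted limit point are positive semidefinite at every
real coupling.** -/
theorem siteBlock_nonneg_of_mem_tiltedBoxLimitPoints_anyBeta (hki : k ≠ i) (hkj : k ≠ j)
    (hij : i ≠ j) (hρ : Continuous ρ) {β : ℝ} {μ : Measure (LGConfig d G)}
    (hμ : μ ∈ tiltedBoxLimitPoints d i j ρ β) {n : ℕ} (F : Fin n → LGConfig d G → ℂ)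
    (hF : ∀ a, Measurable (F a)) (hFb : ∀ a, ∃ C : ℝ, ∀ U, ‖F a U‖ ≤ C)
    (hFS : ∀ a, DependsOn (F a) (siteHalfEdges k)) (c : Fin n → ℂ) :
    0 ≤ ∑ a, ∑ b, conj (c a) * c b * ∫ U, conj (F a (configSiteReflect k U)) * F b U ∂μ := by
  haveI := isProbabilityMeasure_of_mem_tiltedBoxLimitPoints hμ
  exact (siteRP_of_mem_tiltedBoxLimitPoints_anyBeta ρ hki hkj hij hρ hμ).sum_mul_conj_nonneg
    (measurable_configSiteReflect k) F hF hFb hFS c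

end TiltedRP

end Summit.QuantumFields.GaugeBoot
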